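import Mathlib

/-!
# Powers of a sum of square-zero elements; congruences of products modulo an ideal

Blind re-derivation cell `pub-hodge-repro`, seat `night-3` (gen 5).  Mathlib only.  Namespace `HodgeRepro.Night3.SqZero`.

The commutative-ring algebra behind the expansion of the class `Λ = ∏_i L_i^{m−1}` of the form
`Q(x, y) = ∫ x ∧ y ∧ Λ` (night-3's row «the concrete form», NIGHT3.md §11): the `(1,1)`-monomials
`ω_{iρ} = e_{(i,ρ)} ∧ e_{(i,cρ)}` pairwise commute and square to zero, so

* `sum_pow_card_succ_eq_zero`: `(∑_{j ∈ S} x_j)^{|S|+1} = 0` when every `x_j` squares to zero;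
* `sum_pow_card_eq`: `(∑_{j ∈ S} x_j)^{|S|} = |S|! · ∏_{j ∈ S} x_j` — the only surviving term of the
  multinomial expansion is the square-free one, counted `|S|!` times;
* `pow_sub_pow_mem` / `prod_sub_prod_mem`: `u ≡ v (mod J) ⟹ u^k ≡ v^k` and `∏ f ≡ ∏ g (mod J)` —
  the «ideal trick» by which `Λ` is reduced modulo the monomials killed by `ℓ_σ ∧ ℓ_{cσ}` without any
  sign computation.

Nothing here is about Hodge theory; nothing here says anything about the status of the Hodge conjecture for
CM abelian varieties, which is NOT proved.
-/

set_option autoImplicit false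

namespace HodgeRepro.Night3.SqZero

open Finset

variable {R : Type*} [CommRing R] {ι : Type*} [DecidableEq ι]

/-- `x² = 0 ⟹ xᵗ = 0` for `t ≥ 2`. -/
theorem pow_eq_zero_of_sq_eq_zero {x : R} (hx : x ^ 2 = 0) {t : ℕ} (ht : 2 ≤ t) : x ^ t = 0 := by
  obtain ⟨u, rfl⟩ := Nat.exists_eq_add_of_le ht
  rw [pow_add, hx, zero_mul]

/-- **A sum of `|S|` square-zero elements of a commutative ring has vanishing `(|S|+1)`-st power.** -/
theorem sum_pow_card_succ_eq_zero (S : Finset ι) (x : ι → R) (hx : ∀ j ∈ S, x j ^ 2 = 0) :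
    (∑ j ∈ S, x j) ^ (S.card + 1) = 0 := by
  induction S using Finset.induction_on with
  | empty => simp
  | insert j S hj ih =>
    have ih' := ih fun i hi => hx i (mem_insert_of_mem hi)
    rw [sum_insert hj, card_insert_of_notMem hj, add_pow]
    refine Finset.sum_eq_zero fun t _ => ?_
    rcases Nat.lt_or_ge t 2 with h2 | h2
    · interval_cases t
      · rw [pow_zero, one_mul, Nat.sub_zero, pow_succ, ih', zero_mul, zero_mul]
      · rw [pow_one, Nat.add_sub_cancel, ih', mul_zero, zero_mul]
    · rw [pow_eq_zero_of_sq_eq_zero (hx j (mem_insert_self j S)) h2, zero_mul, zero_mul]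

/-- **The `|S|`-th power of a sum of `|S|` square-zero elements**: `(∑_{j ∈ S} x_j)^{|S|} = |S|! · ∏_{j ∈ S} x_j`
(the square-free term of the multinomial expansion, with multiplicity `|S|!`). -/
theorem sum_pow_card_eq (S : Finset ι) (x : ι → R) (hx : ∀ j ∈ S, x j ^ 2 = 0) :
    (∑ j ∈ S, x j) ^ S.card = (S.card.factorial : R) * ∏ j ∈ S, x j := by
  induction S using Finset.induction_on with
  | empty => simp
  | insert j S hj ih =>
    have hx' : ∀ i ∈ S, x i ^ 2 = 0 := fun i hi => hx i (mem_insert_of_mem hi)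
    rw [sum_insert hj, prod_insert hj, card_insert_of_notMem hj, add_pow, Finset.sum_eq_single 1]
    · rw [pow_one, Nat.add_sub_cancel, Nat.choose_one_right, ih hx', Nat.factorial_succ]
      push_cast
      ring
    · intro t _ ht1
      rcases Nat.lt_or_ge t 2 with h2 | h2
      · interval_cases t
        · rw [pow_zero, one_mul, Nat.sub_zero, sum_pow_card_succ_eq_zero S x hx', zero_mul]
        · exact absurd rfl ht1
      · rw [pow_eq_zero_of_sq_eq_zero (hx j (mem_insert_self j S)) h2, zero_mul, zero_mul]
    · intro h
      exact absurd (mem_range.mpr (by omega)) h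

/-- `u ≡ v (mod J) ⟹ uᵏ ≡ vᵏ (mod J)` (`u − v ∣ uᵏ − vᵏ`). -/
theorem pow_sub_pow_mem (J : Ideal R) {u v : R} (h : u - v ∈ J) (k : ℕ) : u ^ k - v ^ k ∈ J := by
  obtain ⟨q, hq⟩ := sub_dvd_pow_sub_pow u v k
  rw [hq]
  exact J.mul_mem_right q h

omit [DecidableEq ι] in
/-- `f ≡ g (mod J)` on `S` `⟹ ∏_{S} f ≡ ∏_{S} g (mod J)`. -/
theorem prod_sub_prod_mem (J : Ideal R) (S : Finset ι) (f g : ι → R) (h : ∀ j ∈ S, f j - g j ∈ J) :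
    (∏ j ∈ S, f j) - ∏ j ∈ S, g j ∈ J := by
  rw [← Ideal.Quotient.eq, map_prod, map_prod]
  exact Finset.prod_congr rfl fun j hj => Ideal.Quotient.eq.mpr (h j hj)

/-- A sum of `|S|` square-zero elements, one of them removed: `(∑_{j ∈ S.erase j₀} x_j)^{|S|−1} = (|S|−1)! · ∏_{S.erase j₀} x_j`. -/
theorem sum_erase_pow_eq (S : Finset ι) (j₀ : ι) (hj₀ : j₀ ∈ S) (x : ι → R) (hx : ∀ j ∈ S, x j ^ 2 = 0) :
    (∑ j ∈ S.erase j₀, x j) ^ (S.card - 1) = ((S.card - 1).factorial : R) * ∏ j ∈ S.erase j₀, x j := by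
  rw [← card_erase_of_mem hj₀]
  exact sum_pow_card_eq (S.erase j₀) x fun j hj => hx j (mem_of_mem_erase hj)

end HodgeRepro.Night3.SqZero
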